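import Mathlib.Tactic.IntervalCases
import Summits.CriticalPhenomena.PercolationContinuityZ3.Theorems.PercNearOneGluingNoHeavyLowerTailSahiSlotPatternComb
import Summits.CriticalPhenomena.PercolationContinuityZ3.Theorems.PercNearOneGluingNoHeavyLowerTailSahiSlotPatternBranching

/-!
# The comb row of the antichain reduction: (M⁺-(n+2)) for families with a member containing the intersection of the others;
# (M⁺-3) UNCONDITIONALLY for every up-set triple on a finite cube with a comparable pair

Support file (lane `prim-masterthm-p3`, generation 18; `--supports stmt-CriticalPhenomena-4575`).  Pure proofs, no definitions,
no `sorry`, standard axioms.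

`…SahiSlotPatternComb` proved: every tensor-Bernstein coefficient of `p ↦ E_n(μ_p; 1_U)` on the cube `2^ι` is a nonnegative combination
of pattern functionals of PULL-BACKS `1_{U'} ∘ slot_r` of the family.  Pull-backs preserve inclusions, so the antichain reduction
(`patternForm_setInd_nonneg_of_inter_subset`, `…SahiSlotPatternBranching`) passes to the comb table:
* `patternForm_pullback_nonneg_of_inter_subset`: for up-sets `U_k` of a grid `Y^d` with `U_j ⊇ ∩_{k≠j} U_k` and ANY slot family `r`,
  `patternForm d (n+2) (1_U ∘ slot_r) ≥ 0`, given `SlotPatternPos d k` for `k ≤ n+1` (sort the axes, then the reduction);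
* `combPos_sahiE_of_inter_subset`: **(M⁺-(n+2)) holds for every increasing family on a finite cube in which some member contains the
  intersection of the others (in particular every family with a comparable pair), given `SlotPatternPos d k` for all `d` and `k ≤ n+1`**;
* **`combPos_sahiE_three_of_inter_subset` / `_of_comparable`: (M⁺-3) — OPEN in general — holds UNCONDITIONALLY for every increasing triple
  `(U_0, U_1, U_2)` on every finite cube with `U_j ⊇ U_k ∩ U_l` for some `j` (e.g. a comparable pair)**, since the cells `(d,1), (d,2)` are
  kernel theorems for all `d`.  A new unconditional row of the comb table (HIERARCHY §4); the open (M⁺-3) lives on triples of pairwise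
  non-containing up-sets. [this work]
-/

namespace Summit.CriticalPhenomena.PercolationContinuityZ3.Theorems

open Finset Function Equiv Equiv.Perm
open Literature.Combinatorics.Sahi2008 Literature.Combinatorics.Sahi2008.CycleForm

namespace SahiSlot

section CombComparable

open SahiComb
open Literature.Probability.Percolation.BHK2006 (weight)
open Literature.Probability.Percolation.DecisionTree (ind)
open scoped Classical

variable {ι : Type} [Fintype ι] {d n : ℕ}

omit [Fintype ι] in
/-- **Pull-backs of a family with a member containing the intersection of the others are `≥ 0` under the pattern functional**
(any slot family `r`; sort the axes, pull back, apply the antichain reduction). [this work] -/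
theorem patternForm_pullback_nonneg_of_inter_subset {Y : Type*} [DecidableEq Y] [LinearOrder Y]
    (hP : ∀ k, 1 ≤ k → k ≤ n + 1 → SlotPatternPos d k) (r : Fin d → Fin (n + 2) → Y)
    (U : Fin (n + 2) → Finset (Fin d → Y)) (hU : ∀ i, IsUpperSet ((U i : Finset (Fin d → Y)) : Set (Fin d → Y)))
    (j : Fin (n + 2)) (hj : ∀ y, (∀ k, k ≠ j → y ∈ U k) → y ∈ U j) :
    0 ≤ patternForm d (n + 2) (fun i => setInd (U i) ∘ slotMap r) := by
  set τ : Fin d → Perm (Fin (n + 2)) := fun a => Tuple.sort (r a) with hτ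
  have hsort : ∀ a, Monotone (r a ∘ τ a) := fun a => Tuple.monotone_sort (r a)
  rw [← patternForm_comp_act _ τ]
  have h2 : (fun i => (setInd (U i) ∘ slotMap r) ∘ act τ) = fun i => setInd (pullSet (fun a => r a ∘ τ a) (U i)) := by
    funext i
    rw [comp_assoc, ← slotMap_comp_act, setInd_comp_slotMap]
  rw [h2]
  refine patternForm_setInd_nonneg_of_inter_subset hP _ (fun i => isUpperSet_pullSet hsort (hU i)) j fun q hq => ?_
  simp only [pullSet, mem_filter, mem_univ, true_and] at hq ⊢
  exact hj _ hq

/-- **(M⁺-(n+2)) FOR FAMILIES WITH A MEMBER CONTAINING THE INTERSECTION OF THE OTHERS**, given the slot cells `(d, k)`, `k ≤ n+1`, all `d`: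
`p ↦ E_{n+2}(μ_p; 1_{W_0}, …, 1_{W_{n+1}})` is comb-positive of multidegree `n+2` on `[0,1]^ι`. [this work] -/
theorem combPos_sahiE_of_inter_subset (hP : ∀ d k, 1 ≤ k → k ≤ n + 1 → SlotPatternPos d k)
    (W : Fin (n + 2) → Set (Set ι)) (hW : ∀ j, IsUpperSet (W j)) (j : Fin (n + 2))
    (hj : ∀ ω, (∀ k, k ≠ j → ω ∈ W k) → ω ∈ W j) :
    CombPos (fun _ : ι => n + 2) (fun p => sahiE (bernoulliWeight p) (n + 2) (fun k => ind (W k))) := by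
  set D := Fintype.card ι
  set e : ι ≃ Fin D := Fintype.equivFin ι
  set U' : Fin (n + 2) → Finset (Q D 2) := fun k => univ.filter fun x => dec e x ∈ W k with hU'
  have hU'up : ∀ k, IsUpperSet ((U' k : Finset (Q D 2)) : Set (Q D 2)) := by
    intro k x x' hxx' hx
    rw [mem_coe] at hx ⊢
    simp only [hU', mem_filter, mem_univ, true_and] at hx ⊢
    exact hW k (dec_mono e hxx') hx
  have hU'j : ∀ y, (∀ k, k ≠ j → y ∈ U' k) → y ∈ U' j := by
    intro y hy
    simp only [hU', mem_filter, mem_univ, true_and] at hy ⊢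
    exact hj _ hy
  set c : ℝ := (Fintype.card (Fin D → Perm (Fin (n + 2))) : ℝ) with hc
  have hcpos : 0 < c := by rw [hc]; exact_mod_cast Fintype.card_pos
  refine ⟨fun m => c⁻¹ * ∑ r ∈ univ.filter (fun r : Fin D → Fin (n + 2) → Fin 2 => prof e r = m),
      patternForm D (n + 2) (fun i => setInd (U' i) ∘ slotMap r), fun m => ?_, fun p => ?_⟩
  · exact mul_nonneg (inv_nonneg.2 hcpos.le)
      (sum_nonneg fun r _ => patternForm_pullback_nonneg_of_inter_subset (hP D) r U' hU'up j hU'j)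
  · dsimp only
    rw [sahiE_bernoulliWeight_eq_gridW p e W]
    have hb := card_mul_sahiE_gridW_eq_sum_patternForm (coin p e) (sum_coin p e) (by omega) (fun k => setInd (U' k))
    have hE : sahiE (gridW (coin p e)) (n + 2) (fun k => setInd (U' k)) =
        c⁻¹ * ∑ r : Fin D → Fin (n + 2) → Fin 2, slotW (coin p e) r * patternForm D (n + 2) (fun i => setInd (U' i) ∘ slotMap r) := by
      rw [← hb, ← mul_assoc, inv_mul_cancel₀ hcpos.ne', one_mul]
    have hfib : ∑ r : Fin D → Fin (n + 2) → Fin 2, slotW (coin p e) r * patternForm D (n + 2) (fun i => setInd (U' i) ∘ slotMap r) =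
        ∑ m ∈ box (fun _ : ι => n + 2), ∑ r ∈ univ.filter (fun r : Fin D → Fin (n + 2) → Fin 2 => prof e r = m),
          slotW (coin p e) r * patternForm D (n + 2) (fun i => setInd (U' i) ∘ slotMap r) :=
      (sum_fiberwise_of_maps_to (fun r _ => prof_mem_box e r) _).symm
    rw [hE, hfib, mul_sum]
    refine sum_congr rfl fun m _ => ?_
    rw [mul_sum, mul_sum, sum_mul]
    refine sum_congr rfl fun r hr => ?_
    rw [mem_filter] at hr
    rw [slotW_coin_eq_bern, hr.2]
    ring

/-- **(M⁺-(n+2)) for families with a comparable pair**, given the lower slot cells. [this work] -/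
theorem combPos_sahiE_of_comparable (hP : ∀ d k, 1 ≤ k → k ≤ n + 1 → SlotPatternPos d k)
    (W : Fin (n + 2) → Set (Set ι)) (hW : ∀ j, IsUpperSet (W j)) {i j : Fin (n + 2)} (hij : i ≠ j) (hWij : W i ⊆ W j) :
    CombPos (fun _ : ι => n + 2) (fun p => sahiE (bernoulliWeight p) (n + 2) (fun k => ind (W k))) :=
  combPos_sahiE_of_inter_subset hP W hW j fun _ hω => hWij (hω i hij)

/-- The lower cells at order `3`: `(d,1)` and `(d,2)` for every `d`. [this work] -/
theorem slotPatternPos_of_le_two' (d k : ℕ) (hk1 : 1 ≤ k) (hk2 : k ≤ 2) : SlotPatternPos d k := by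
  interval_cases k
  · exact slotPatternPos_one d
  · exact slotPatternPos_two d

/-- **(M⁺-3) UNCONDITIONALLY for triples with a member containing the meet of the other two** (every finite cube). [this work] -/
theorem combPos_sahiE_three_of_inter_subset (W : Fin 3 → Set (Set ι)) (hW : ∀ j, IsUpperSet (W j)) (j : Fin 3)
    (hj : ∀ ω, (∀ k, k ≠ j → ω ∈ W k) → ω ∈ W j) :
    CombPos (fun _ : ι => 3) (fun p => sahiE (bernoulliWeight p) 3 (fun k => ind (W k))) :=
  combPos_sahiE_of_inter_subset (n := 1) (fun d k hk1 hk2 => slotPatternPos_of_le_two' d k hk1 hk2) W hW j hj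

/-- **(M⁺-3) UNCONDITIONALLY for triples with a comparable pair** (every finite cube): the open comb conjecture at order 3 lives on
triples of pairwise non-containing up-sets. [this work] -/
theorem combPos_sahiE_three_of_comparable (W : Fin 3 → Set (Set ι)) (hW : ∀ j, IsUpperSet (W j)) {i j : Fin 3} (hij : i ≠ j)
    (hWij : W i ⊆ W j) : CombPos (fun _ : ι => 3) (fun p => sahiE (bernoulliWeight p) 3 (fun k => ind (W k))) :=
  combPos_sahiE_of_comparable (n := 1) (fun d k hk1 hk2 => slotPatternPos_of_le_two' d k hk1 hk2) W hW hij hWij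

/-- **(M⁺-(n+2)) REDUCES TO NON-CONTAINING CUBE FAMILIES**, given the slot cells `(d, k)`, `k ≤ n+1`. [this work] -/
theorem masterFamilyCombPos_of_noncontaining (hP : ∀ d k, 1 ≤ k → k ≤ n + 1 → SlotPatternPos d k)
    (hcore : ∀ (ι : Type) [Fintype ι] (W : Fin (n + 2) → Set (Set ι)), (∀ j, IsUpperSet (W j)) →
      (∀ j, ∃ ω, (∀ k, k ≠ j → ω ∈ W k) ∧ ω ∉ W j) →
      CombPos (fun _ : ι => n + 2) (fun p => sahiE (bernoulliWeight p) (n + 2) (fun k => ind (W k)))) :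
    MasterFamilyCombPos (n + 2) := by
  intro ι _ W hW
  by_cases h : ∃ j, ∀ ω, (∀ k, k ≠ j → ω ∈ W k) → ω ∈ W j
  · obtain ⟨j, hj⟩ := h
    exact combPos_sahiE_of_inter_subset hP W hW j hj
  · push Not at h
    exact hcore ι W hW h

/-- **(M⁺-3) REDUCES TO NON-CONTAINING CUBE TRIPLES, unconditionally** (the cells `(d,1), (d,2)` are theorems). [this work] -/
theorem masterFamilyCombPos_three_of_noncontaining
    (hcore : ∀ (ι : Type) [Fintype ι] (W : Fin 3 → Set (Set ι)), (∀ j, IsUpperSet (W j)) →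
      (∀ j, ∃ ω, (∀ k, k ≠ j → ω ∈ W k) ∧ ω ∉ W j) →
      CombPos (fun _ : ι => 3) (fun p => sahiE (bernoulliWeight p) 3 (fun k => ind (W k)))) :
    MasterFamilyCombPos 3 :=
  masterFamilyCombPos_of_noncontaining (n := 1) (fun d k hk1 hk2 => slotPatternPos_of_le_two' d k hk1 hk2) hcore

end CombComparable

end SahiSlot

end Summit.CriticalPhenomena.PercolationContinuityZ3.Theorems
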